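import Summits.ValiantsHypothesis.ValiantsHypothesis.Theorems.GrenetZeonDualUnipotentThreeHalvesHeavyTopThmCIdentities
import Summits.ValiantsHypothesis.ValiantsHypothesis.Theorems.GrenetZeonDualUnipotentThreeHalvesHeavyTopThmCLinAlg

/-!
# `GrenetZeon.DualUnipotentThreeHalves` (stmt-ValiantsHypothesis-24318), R2 heavy-top instrument — uniform Theorem C toolkit:
# a ONE-dimensional lower piece at a zero-slack height is a THEOREM-A LINE `ℂ(e_a − e_{a+h})`, at ANY height

Experiment cell «val-heavytop-census» (D-0160), engine seat val-htc-eng-1 g5.  Frame of the Thm C(n) ports (graded nilpotent `W ≤ M_n(ℂ)`, `P_h = W.map (dp h)`,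
`N_h = W.map (dm h)`).  The second half of ✓ `…ThmCLemmaRb.shape`, freed of the lowest-weight / deficient-height context: it uses only the height-`h`
pair identity ✓ `sum_sq_add_two_mul_sum_eq_zero`, zero slack at `h` (`P_h = N_h^⊥`) and the zero sums on `N_h` (which need only `J ∈ W`).

* ★ `line_shape` — if `dim N_h = 1` and `dim P_h + dim N_h = n − h` (`h ≥ 1`), then `N_h = ℂ(e_a − e_{a+h})` for some `a` with `a + 2h < n`.

Use: the structural rigidity of zero-slack heights (crux note `CENSUS-THMC-UNIFORM-eng1g5.md` §7.7) — the entry point for the deficiency-2 leaves and the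
non-regular strata, where lower pieces occur at heights other than the lowest weight.  Honest framing: infrastructure; nothing here proves or refutes
`HeavyTopLaw`/`HeavyTopSlowLaw`, 24318, S3 or 8062; `VP ≠ VNP` is NOT proved.  No definitions.  [this seat]
-/

noncomputable section

-- single-conjunct layout: Sub = Summit, duplicated namespace component intended
set_option linter.dupNamespace false

namespace Summit.ValiantsHypothesis.ValiantsHypothesis.Theorems.GrenetZeon.HeavyTopThmCLineShape

open Matrix
open Summit.ValiantsHypothesis.ValiantsHypothesis.Theorems.GrenetZeon.HeavyTopThmCBandCalculus (sum_sq_add_two_mul_sum_eq_zero)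
open Summit.ValiantsHypothesis.ValiantsHypothesis.Theorems.GrenetZeon.HeavyTopThmCIdentities (upper_band_mem sum_ite_eq_val)
open Summit.ValiantsHypothesis.ValiantsHypothesis.Theorems.GrenetZeon.HeavyTopThmCnStructure (lower_band_mem)
open Summit.ValiantsHypothesis.ValiantsHypothesis.Theorems.GrenetZeon.HeavyTopThmCStructure (mem_of_dot_eq_zero)

variable {n : ℕ}

/-- ★ **A one-dimensional lower piece at a zero-slack height is a Theorem-A line.**  In a graded nilpotent `W ∋ J` with the diagonal maps `dp h`, `dm h`:
if at height `s ≥ 1` the pieces satisfy `N_s ⊥ P_s`, `dim P_s + dim N_s = n − s`, zero sums on `N_s`, and `dim N_s = 1`, then `N_s = ℂ(e_a − e_{a+s})` for some `a`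
with `a + 2s < n`.  (Two support indices of the generator differ by exactly `s`: the pair identity at the test vector `e_i/y(i) − e_j/y(j) ∈ P_s` reads
`2 − 2[|i−j| = s] = 0`.) [this seat; = ✓ `shape` (iv)–(v) at an arbitrary height] -/
theorem line_shape (W : Submodule ℂ (Matrix (Fin n) (Fin n) ℂ)) (hW : ∀ A ∈ W, IsNilpotent A)
    (hgr : ∀ A ∈ W, ∀ d : ℤ, (Matrix.of fun a b : Fin n => if (b : ℤ) - (a : ℤ) = d then A a b else 0) ∈ W)
    (dp dm : ∀ h : ℕ, Matrix (Fin n) (Fin n) ℂ →ₗ[ℂ] (Fin (n - h) → ℂ))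
    (hdp : ∀ h A (i : Fin (n - h)) (a b : Fin n), (a : ℕ) = i → (b : ℕ) = i + h → dp h A i = A a b)
    (hdm : ∀ h A (i : Fin (n - h)) (a b : Fin n), (a : ℕ) = i + h → (b : ℕ) = i → dm h A i = A a b)
    {s : ℕ} (hs : 1 ≤ s)
    (hPNs : ∀ q ∈ W.map (dm s), ∀ p ∈ W.map (dp s), q ⬝ᵥ p = 0)
    (gsums : Module.finrank ℂ (W.map (dp s)) + Module.finrank ℂ (W.map (dm s)) = n - s)
    (hN1s : ∀ q ∈ W.map (dm s), q ⬝ᵥ (fun _ => (1 : ℂ)) = 0)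
    (hdim : Module.finrank ℂ (W.map (dm s)) = 1) :
    ∃ (a : ℕ) (ha : a + 2 * s < n),
      (Pi.single (⟨a, by omega⟩ : Fin (n - s)) (1 : ℂ) - Pi.single (⟨a + s, by omega⟩ : Fin (n - s)) (1 : ℂ)) ∈ W.map (dm s) ∧
      ∀ q ∈ W.map (dm s), ∃ t : ℂ, q = t • (Pi.single (⟨a, by omega⟩ : Fin (n - s)) (1 : ℂ) - Pi.single (⟨a + s, by omega⟩ : Fin (n - s)) (1 : ℂ)) := by
  classical
  have ext_dm : ∀ B ∈ W, (Matrix.of fun a b : Fin n => if (a : ℕ) = (b : ℕ) + s then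
      (fun i : Fin n => if hi : (i : ℕ) < n - s then dm s B ⟨(i : ℕ), hi⟩ else 0) b else 0) ∈ W :=
    fun B hB => lower_band_mem W hgr s (dm s) (hdm s) B hB _ (fun i => by simp only [dif_pos (show (i : ℕ) < n - s from i.isLt)])
  have ext_dp : ∀ h, ∀ A ∈ W, (Matrix.of fun a b : Fin n => if (b : ℕ) = (a : ℕ) + h then
      (fun i : Fin n => if hi : (i : ℕ) < n - h then dp h A ⟨(i : ℕ), hi⟩ else 0) a else 0) ∈ W :=
    fun h A hA => upper_band_mem W hgr h (dp h) (hdp h) A hA _ (fun i => by simp only [dif_pos (show (i : ℕ) < n - h from i.isLt)])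
  have hne : W.map (dm s) ≠ ⊥ := fun h0 => by rw [h0, finrank_bot] at hdim; exact absurd hdim (by norm_num)
  -- the generator `y₀` and `P_s = y₀^⊥`
  obtain ⟨y₀, hy₀N, hy₀⟩ := Submodule.exists_mem_ne_zero_of_ne_bot hne
  have hline : ∀ q ∈ W.map (dm s), ∃ t : ℂ, q = t • y₀ := by
    intro q hq
    have h1 := (finrank_eq_one_iff_of_nonzero' (⟨y₀, hy₀N⟩ : W.map (dm s)) (by
      intro h; apply hy₀; exact congrArg Subtype.val h)).1 hdim ⟨q, hq⟩
    obtain ⟨t, ht⟩ := h1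
    exact ⟨t, by have := congrArg Subtype.val ht; simpa using this.symm⟩
  have hPs : ∀ x : Fin (n - s) → ℂ, x ⬝ᵥ y₀ = 0 → x ∈ W.map (dp s) := by
    intro x hx
    refine mem_of_dot_eq_zero (W.map (dm s)) (W.map (dp s)) (fun q hq p hp => by rw [dotProduct_comm]; exact hPNs p hp q hq)
      (by omega) x (fun q hq => ?_)
    obtain ⟨t, rfl⟩ := hline q hq
    rw [dotProduct_smul, hx, smul_zero]
  -- (iv) two support indices of `y₀` differ by exactly `s`
  have htwo : ∀ i₁ i₂ : Fin (n - s), i₁ ≠ i₂ → y₀ i₁ ≠ 0 → y₀ i₂ ≠ 0 → (i₂ : ℕ) = (i₁ : ℕ) + s ∨ (i₁ : ℕ) = (i₂ : ℕ) + s := by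
    intro i₁ i₂ hne12 h1 h2
    by_contra hcon
    push Not at hcon
    set x : Fin (n - s) → ℂ := (y₀ i₁)⁻¹ • Pi.single i₁ 1 - (y₀ i₂)⁻¹ • Pi.single i₂ 1 with hxdef
    have hxy : x ⬝ᵥ y₀ = 0 := by
      rw [hxdef, sub_dotProduct, smul_dotProduct, smul_dotProduct, single_dotProduct, single_dotProduct, one_mul, one_mul,
        smul_eq_mul, smul_eq_mul, inv_mul_cancel₀ h1, inv_mul_cancel₀ h2, sub_self]
    obtain ⟨A, hA, hAx⟩ := hPs x hxy
    obtain ⟨B, hB, hBy⟩ : y₀ ∈ W.map (dm s) := hy₀N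
    have hQ := sum_sq_add_two_mul_sum_eq_zero W hW s _ _ (ext_dp s A hA) (ext_dm B hB)
    rw [hAx, hBy] at hQ
    -- pointwise: the product vector is `e_{i₁} − e_{i₂}`
    have hw : ∀ a : Fin n, (if (a : ℕ) + s < n then
        (fun i : Fin n => if hi : (i : ℕ) < n - s then x ⟨(i : ℕ), hi⟩ else 0) a *
        (fun i : Fin n => if hi : (i : ℕ) < n - s then y₀ ⟨(i : ℕ), hi⟩ else 0) a else 0) =
        (if (a : ℕ) = (i₁ : ℕ) then (1 : ℂ) else 0) - (if (a : ℕ) = (i₂ : ℕ) then (1 : ℂ) else 0) := by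
      intro a
      by_cases ha : (a : ℕ) + s < n
      · rw [if_pos ha]; dsimp only
        rw [dif_pos (by omega), dif_pos (by omega), hxdef]
        simp only [Pi.sub_apply, Pi.smul_apply, Pi.single_apply, smul_eq_mul, Fin.ext_iff]
        have hne' : (i₁ : ℕ) ≠ (i₂ : ℕ) := fun e => hne12 (Fin.ext e)
        by_cases ha1 : (a : ℕ) = (i₁ : ℕ)
        · simp only [ha1, hne', if_true, if_false]
          have : y₀ ⟨(i₁ : ℕ), by omega⟩ = y₀ i₁ := congrArg y₀ (Fin.ext rfl)
          rw [this]; simp [h1]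
        · by_cases ha2 : (a : ℕ) = (i₂ : ℕ)
          · simp only [ha2, hne'.symm, if_true, if_false]
            have : y₀ ⟨(i₂ : ℕ), by omega⟩ = y₀ i₂ := congrArg y₀ (Fin.ext rfl)
            rw [this]; simp [h2]
          · simp only [ha1, ha2, if_false]; ring
      · rw [if_neg ha, if_neg (by omega), if_neg (by omega), sub_zero]
    have hw' : ∀ a : Fin n, ∀ ha : (a : ℕ) + s < n,
        (fun i : Fin n => if hi : (i : ℕ) < n - s then x ⟨(i : ℕ), hi⟩ else 0) a *
        (fun i : Fin n => if hi : (i : ℕ) < n - s then y₀ ⟨(i : ℕ), hi⟩ else 0) a =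
        (if (a : ℕ) = (i₁ : ℕ) then (1 : ℂ) else 0) - (if (a : ℕ) = (i₂ : ℕ) then (1 : ℂ) else 0) := by
      intro a ha; have := hw a; rwa [if_pos ha] at this
    -- the squares sum to `2`, the shifted products vanish
    have hsq : ∀ a : Fin n, (if (a : ℕ) + s < n then
        (fun i : Fin n => if hi : (i : ℕ) < n - s then x ⟨(i : ℕ), hi⟩ else 0) a *
        (fun i : Fin n => if hi : (i : ℕ) < n - s then y₀ ⟨(i : ℕ), hi⟩ else 0) a else 0) ^ 2 =
        (if (a : ℕ) = (i₁ : ℕ) then (1 : ℂ) else 0) + (if (a : ℕ) = (i₂ : ℕ) then (1 : ℂ) else 0) := by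
      intro a; rw [hw a]
      have : (i₁ : ℕ) ≠ (i₂ : ℕ) := fun e => hne12 (Fin.ext e)
      split_ifs <;> first | (exfalso; omega) | norm_num
    have hpr : ∀ a : Fin n, (if ha : (a : ℕ) + 2 * s < n then
        (fun i : Fin n => if hi : (i : ℕ) < n - s then x ⟨(i : ℕ), hi⟩ else 0) a *
        (fun i : Fin n => if hi : (i : ℕ) < n - s then y₀ ⟨(i : ℕ), hi⟩ else 0) a *
        ((fun i : Fin n => if hi : (i : ℕ) < n - s then x ⟨(i : ℕ), hi⟩ else 0) ⟨(a : ℕ) + s, by omega⟩ *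
         (fun i : Fin n => if hi : (i : ℕ) < n - s then y₀ ⟨(i : ℕ), hi⟩ else 0) ⟨(a : ℕ) + s, by omega⟩) else 0) = 0 := by
      intro a
      by_cases ha : (a : ℕ) + 2 * s < n
      · rw [dif_pos ha, hw' a (by omega), hw' ⟨(a : ℕ) + s, by omega⟩ (by dsimp only; omega)]
        dsimp only
        have : (i₁ : ℕ) ≠ (i₂ : ℕ) := fun e => hne12 (Fin.ext e)
        split_ifs <;> first | (exfalso; omega) | norm_num
      · rw [dif_neg ha]
    rw [Finset.sum_congr rfl (fun a _ => hsq a), Finset.sum_congr rfl (fun a _ => hpr a), Finset.sum_const_zero, mul_zero, add_zero,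
      Finset.sum_add_distrib, sum_ite_eq_val, sum_ite_eq_val, dif_pos (show (i₁ : ℕ) < n by omega), dif_pos (show (i₂ : ℕ) < n by omega)] at hQ
    norm_num at hQ
  -- (v) the support of `y₀` is `{a, a+s}` with opposite values
  obtain ⟨a, ha0, hamin⟩ : ∃ a : Fin (n - s), y₀ a ≠ 0 ∧ ∀ j : Fin (n - s), y₀ j ≠ 0 → (a : ℕ) ≤ (j : ℕ) := by
    set T : Finset (Fin (n - s)) := Finset.univ.filter fun i : Fin (n - s) => y₀ i ≠ 0 with hTdef
    have memT : ∀ i, i ∈ T ↔ y₀ i ≠ 0 := fun i => by simp [hTdef]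
    have hT : T.Nonempty := by
      by_contra h
      rw [Finset.not_nonempty_iff_eq_empty] at h
      apply hy₀; funext i
      by_contra hi
      have := (memT i).2 hi
      rw [h] at this; simp at this
    refine ⟨T.min' hT, (memT _).1 (Finset.min'_mem T hT), fun j hj => ?_⟩
    exact Fin.le_def.1 (Finset.min'_le T j ((memT j).2 hj))
  have hsupp : ∀ j : Fin (n - s), y₀ j ≠ 0 → (j : ℕ) = (a : ℕ) ∨ (j : ℕ) = (a : ℕ) + s := by
    intro j hj
    by_cases hja : j = a
    · exact Or.inl (congrArg Fin.val hja)
    · rcases htwo a j (Ne.symm hja) ha0 hj with h | h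
      · exact Or.inr h
      · have := hamin j hj; omega
  have hsum := hN1s y₀ hy₀N
  rw [dotProduct] at hsum
  simp only [mul_one] at hsum
  -- `a + s` is a support index (else the sum would be `y₀ a ≠ 0`)
  have has : ∃ hlt : (a : ℕ) + s < n - s, y₀ ⟨(a : ℕ) + s, hlt⟩ = - y₀ a := by
    by_cases hlt : (a : ℕ) + s < n - s
    · have h2 : ∑ j : Fin (n - s), y₀ j = y₀ a + y₀ ⟨(a : ℕ) + s, hlt⟩ := by
        rw [← Finset.sum_subset (Finset.subset_univ ({a, ⟨(a : ℕ) + s, hlt⟩} : Finset (Fin (n - s))))]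
        · rw [Finset.sum_pair]; intro h; have := congrArg Fin.val h; simp at this; omega
        · intro j _ hj
          by_contra hj0
          rcases hsupp j hj0 with h | h
          · exact hj (by rw [Finset.mem_insert]; exact Or.inl (Fin.ext h))
          · exact hj (by rw [Finset.mem_insert, Finset.mem_singleton]; exact Or.inr (Fin.ext h))
      rw [h2] at hsum
      exact ⟨hlt, by linear_combination hsum⟩
    · exfalso
      have h2 : ∑ j : Fin (n - s), y₀ j = y₀ a := by
        rw [← Finset.sum_subset (Finset.subset_univ ({a} : Finset (Fin (n - s)))), Finset.sum_singleton]
        intro j _ hj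
        by_contra hj0
        rcases hsupp j hj0 with h | h
        · exact hj (Finset.mem_singleton.2 (Fin.ext h))
        · have := j.isLt; omega
      rw [h2] at hsum; exact ha0 hsum
  obtain ⟨hlt, hopp⟩ := has
  have ha2s : (a : ℕ) + 2 * s < n := by omega
  set t₀ : ℂ := y₀ a with ht₀
  have hy₀e : y₀ = t₀ • (Pi.single (⟨(a : ℕ), by omega⟩ : Fin (n - s)) (1 : ℂ) - Pi.single (⟨(a : ℕ) + s, by omega⟩ : Fin (n - s)) (1 : ℂ)) := by
    funext j
    simp only [Pi.smul_apply, Pi.sub_apply, Pi.single_apply, smul_eq_mul, Fin.ext_iff]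
    by_cases hj0 : y₀ j = 0
    · rw [hj0]
      by_cases hja : (j : ℕ) = (a : ℕ)
      · exfalso; exact ha0 (by rw [← hj0]; exact congrArg y₀ (Fin.ext hja.symm))
      · rw [if_neg hja]
        by_cases hjs : (j : ℕ) = (a : ℕ) + s
        · exfalso; apply ha0
          have : y₀ ⟨(a : ℕ) + s, by omega⟩ = 0 := by rw [← hj0]; exact congrArg y₀ (Fin.ext hjs.symm)
          rw [this] at hopp; linear_combination hopp
        · rw [if_neg hjs]; ring
    · rcases hsupp j hj0 with h | h
      · rw [if_pos h, if_neg (by omega), show j = a from Fin.ext h]; ring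
      · rw [if_neg (by omega), if_pos h, show j = ⟨(a : ℕ) + s, by omega⟩ from Fin.ext h, hopp]; ring
  refine ⟨(a : ℕ), ha2s, ?_, fun q hq => ?_⟩
  · have h := Submodule.smul_mem (W.map (dm s)) t₀⁻¹ hy₀N
    rw [hy₀e, smul_smul, inv_mul_cancel₀ ha0, one_smul] at h
    exact h
  · obtain ⟨t, rfl⟩ := hline q hq
    exact ⟨t * t₀, by rw [hy₀e, smul_smul]⟩


end Summit.ValiantsHypothesis.ValiantsHypothesis.Theorems.GrenetZeon.HeavyTopThmCLineShape

end
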